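import Summits.BirchSwinnertonDyer.BirchSwinnertonDyer.Theorems.ClassRecordThreeShimuraKolyvaginCebotarevOfImage
import Summits.BirchSwinnertonDyer.BirchSwinnertonDyer.Theorems.ClassRecordThreeShimuraKolyvaginFixedOfTorsion
import HarnessLib

/-!
# The IMAGE-KEYED Kolyvagin ORDER machine, I2: McCallum's Cor. 3.2 at level `p^M` with Kolyvagin primes of
# depth `M + k`, from the four image inputs instead of `ρ̄_{E,p}` onto
# (crux `CornerAtThree`, item stmt-BirchSwinnertonDyer-19111, conjunct 3 along the CARRIER-INERT Shimura road;
# cell `bsd-stepL`, seat `bsd-stepL-corner3-p2` g5 = WIDTH-LEVER lane B; `--supports … --as helper`)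

HONEST FRAMING: THEOREMS ONLY (no definition, no named fact, no `sorry`); nothing here is a BSD class theorem;
no census label moves (T7); item 19111 is NOT closed. BSD is not proved by any of this.

## What this file does (and why)

Lane B's typed object `Theorems.CornerAtThreeShimuraInertDisplay` (conjunct 1 of the registered stub
`stub_upper3_inertDisplay` of `Cruxes/CornerAtThree/Lines/inert.lean`, planner RULING 35) is Kolyvagin's UNSHARP
order bound `#Ш(E/K)[3^∞] ≤ 3^(2·ord₃[E(K):ℤP])` for the CM point of `X_{N⁺,N⁻}` with `3 ∣ N⁻` on the (T4″)₃
corner (`E[3]` irreducible, `ρ̄_{E,3}` NOT onto). The tree's Shimura–Kolyvagin ORDER chain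
(`ErratumRoadFiveShimuraKolyvaginOrderBoundInert*` ∕ `ClassRecordThreeShimuraKolyvaginOrderBoundAtThreeSurjOrderShift*`,
seats shim-p1 ∕ shim3a) is keyed on `hρ : ρ̄_{E,p}` ONTO, which it reads ONLY through four consequences — seat
shim3b g4 ∕ g5's finding (memo `shim/SHIM3B-G5-NOTE-19616.md` §2, «execute only if a consumer appears»; the
consumer is lane B's inert line): (hIz) some `z ∈ Γ_K` acts as `−1` on `E(K̄)[p]`, (hIs) `E(K̄)[p]` is a
simple `Γ_K`-module, (hIc) its `Γ_K`-commutant is scalar, (hIt) `E(K)[p] = 0`. This series of files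
(`ClassRecordThreeCornerAtThreeKolyImage*.lean`, namespace `…Theorems.ShimuraKolyvaginOfImage`, theorem names =
the originals + `_ofImage`) re-keys the chain on these four inputs, statement-copying the intermediate theorems
with the binder `hρ` replaced and the leaves replaced by shim3b's landed image-keyed twins; at `p = 3` all
four inputs hold for EVERY irreducible `E[3]` (`kolyvaginImageInputs_three_of_mem_inertSet`). THIS FILE = I2
of shim3b's inventory: shim-p1's `McCallum1991_cor_3_2_pow_shift_of_chebotarev` (p480700).

References: [McCallumLMS1991] §3 Prop. 3.1, Cor. 3.2, §4 Lemma 4.6; [Howard2004Duke] Thm. 3.2.2 (proof);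
[GrossLMS1991] §3 (3.2), §9.
presearch: Kolyvagin order bound at an inert p = 3 ∣ N⁻ for non-surjective irreducible image → NOT PRINTED (cell
D8 audit `audit/LIT-AUDIT-D8-19899-fullimage-at3-lit-g15.md`; Kim 2024 Thm 4.3 cites Kolyvagin ∕ W. Zhang, both
`ρ̄` onto); corpus + galaxy nothing beyond (shim3b g5 §1).
-/

set_option autoImplicit false
set_option linter.dupNamespace false

noncomputable section

open scoped Classical Pointwise

open WeierstrassCurve NumberField IsDedekindDomain Field
  Literature.NumberTheory.EllipticCurves Literature.NumberTheory.GaloisRepresentations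
  Summit.BirchSwinnertonDyer.Rank1Residual

universe u

namespace Summit.BirchSwinnertonDyer.BirchSwinnertonDyer.Theorems.ShimuraKolyvaginOfImage

variable {W : WeierstrassCurve ℚ} {K : Type u} [Field K] [NumberField K]

/-- **McCallum 1991, Cor. 3.2 ONE LEVEL DEEPER: Kolyvagin primes of depth `M + k` with prescribed
local orders of LEVEL-`p^M` classes.** Hypotheses exactly those of x11b3's
`McCallum1991_cor_3_2_pow_of_chebotarev` (the `cebotarev` field of `KolyvaginDescent.HypothesesM` at
level `p^M`): `K` imaginary quadratic with complex conjugation `c`; `p` odd with a Weil pairing on `E[p]` and — IN PLACE OF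
`ρ̄_{E,p}` onto — the four IMAGE INPUTS (hIz) some `z ∈ Γ_K` acts as `−1` on `E(K̄)[p]`, (hIs) `E(K̄)[p]` simple,
(hIc) scalar `Γ_K`-commutant, (hIt) `E(K)[p] = 0`; non-zero independent `τ`-eigenclasses `c_i ∈ H¹(K, E[p^M])`; `N_i` with
`p^{N_i−1} c_i ≠ 0`; the Čebotarev density theorem. Conclusion: above every bound a Kolyvagin prime `ℓ`
(`IsKolyvaginPrime N W K p ℓ`) with **`Frob(ℓ) = Frob(∞)` in `Gal(K(E[p^{M+k}])/ℚ)`**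
(`FrobEqFrobInfty W K (p^(M+k)) ℓ`, so `a_ℓ ≡ ℓ + 1 ≡ 0 mod p^{M+k}`) and `ord c_{i,λ} = p^{N_i}` at
`λ ∋ ℓ`. Proof: apply the level-`p^{M+k}` theorem to `ι_* c_i ∈ H¹(K, E[p^{M+k}])` — still non-zero,
independent, `τ`-eigen with the same orders (`ι_*` is injective, §2, and `Aut(K/ℚ)`-equivariant, §1) —
with the bound raised above the rational primes under the bad places of `E/K`; at the resulting `λ`,
`E/K` has good reduction and `Γ_{K_λ}` fixes `E[p^{M+k}]`
(`absGaloisRestrict_smul_geomTorsion_eq_of_kolyvaginPrime`), so `(p^a c_i)_λ = 0 ↔ (p^a ι_* c_i)_λ = 0`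
(§3). This is the Čebotarev input of the LEVEL-SHIFT road (McCallum L4.6 ∕ Howard Thm. 3.2.2: classes at
level `p^M`, primes in `S(M+k)`). IMAGE-KEYED twin of shim-p1's `McCallum1991_cor_3_2_pow_shift_of_chebotarev`
(proof verbatim; the two leaves are shim3b's `torsionH1OfDvd_pow_injective_of_torsionBy_eq_bot` and
`McCallum1991_cor_3_2_pow_of_image`), so that it holds for EVERY image delivering the four inputs — e.g. `E[3]`
irreducible NOT onto on the (T4″)₃ corner (`kolyvaginImageInputs_three_of_mem_inertSet`).
[cite: McCallumLMS1991, §3 Cor. 3.2 (with Prop. 3.1), §4 Lemma 4.6] [cite: Howard2004Duke, Thm. 3.2.2 (proof)]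
[cite: GrossLMS1991, §3 (3.2), §9] -/
theorem McCallum1991_cor_3_2_pow_shift_of_chebotarev_ofImage
    (hC : Literature.NumberTheory.Automorphic.chebotarev_artinRep)
    {N : ℕ} [NeZero N] [W.IsElliptic] (hK : IsImaginaryQuadratic K) {p : ℕ} (hp : p.Prime)
    (hp2 : p ≠ 2)
    (hIz : ∃ z : absoluteGaloisGroup K, ∀ t : geomTorsion (W.baseChange K) p, z • t = -t)
    (hIs : (W.baseChange K).HasIrreducibleModPGaloisRep p)
    (hIc : ∀ f : geomTorsion (W.baseChange K) p →+ geomTorsion (W.baseChange K) p,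
      (∀ (g : absoluteGaloisGroup K) (t : geomTorsion (W.baseChange K) p), f (g • t) = g • f t) →
        ∃ k : ℤ, ∀ t, f t = k • t)
    (hIt : AddSubgroup.torsionBy (W.baseChange K).toAffine.Point (p : ℤ) = ⊥)
    (hW : W.exists_weilPairing p) {M : ℕ}
    (hM : 1 ≤ M) (k : ℕ) {c : K ≃ₐ[ℚ] K} (hc : c ≠ 1) {r : ℕ}
    (cs : Fin r → galH1Torsion (W.baseChange K) ((p ^ M : ℕ) : ℤ)) (h0 : ∀ i, cs i ≠ 0)
    (Nv : Fin r → ℕ) (hN : ∀ i, Nv i ≠ 0 → ((p : ℤ) ^ (Nv i - 1)) • cs i ≠ 0)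
    (hτ : ∀ i, ∃ e : ℤ, (e = 1 ∨ e = -1) ∧ conjAct W c ((p ^ M : ℕ) : ℤ) (cs i) = e • cs i)
    (hind : ∀ a : Fin r → ℤ, ∑ i, a i • cs i = 0 → ∀ i, a i • cs i = 0) (b : ℕ) :
    ∃ ℓ : ℕ, b < ℓ ∧ IsKolyvaginPrime N W K p ℓ ∧ FrobEqFrobInfty W K (p ^ (M + k)) ℓ ∧
      ∀ i, ∀ v : HeightOneSpectrum (𝓞 K), (ℓ : 𝓞 K) ∈ v.asIdeal →
        (((p : ℤ) ^ Nv i) • cs i ∈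
            (W.baseChange K).torsionLocalKer (v.adicCompletion K) ((p ^ M : ℕ) : ℤ) ∧
          (Nv i ≠ 0 → ((p : ℤ) ^ (Nv i - 1)) • cs i ∉
            (W.baseChange K).torsionLocalKer (v.adicCompletion K) ((p ^ M : ℕ) : ℤ))) := by
  classical
  haveI : (W.baseChange K).IsElliptic := inferInstanceAs (W.map (algebraMap ℚ K)).IsElliptic
  have hdvd := natCast_pow_dvd_natCast_pow_add p M k
  set ι := torsionH1OfDvd (W.baseChange K) hdvd with hιdef
  have hιinj : Function.Injective ι :=
    ShimuraKolyvaginFixedOfTorsion.torsionH1OfDvd_pow_injective_of_torsionBy_eq_bot W hIt M k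
  -- ### the shifted classes `ι_* c_i ∈ H¹(K, E[p^{M+k}])`
  set cs' : Fin r → galH1Torsion (W.baseChange K) ((p ^ (M + k) : ℕ) : ℤ) := fun i ↦ ι (cs i)
    with hcs'
  have h0' : ∀ i, cs' i ≠ 0 := fun i h ↦ h0 i (hιinj (by rw [map_zero]; exact h))
  have hN' : ∀ i, Nv i ≠ 0 → ((p : ℤ) ^ (Nv i - 1)) • cs' i ≠ 0 := fun i hi h ↦
    hN i hi (hιinj (by rw [map_zsmul, map_zero]; exact h))
  have hτ' : ∀ i, ∃ e : ℤ, (e = 1 ∨ e = -1) ∧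
      conjAct W c ((p ^ (M + k) : ℕ) : ℤ) (cs' i) = e • cs' i := fun i ↦ by
    obtain ⟨e, he, hec⟩ := hτ i
    exact ⟨e, he, by rw [hcs', conjAct_torsionH1OfDvd, hec, map_zsmul]⟩
  have hind' : ∀ a : Fin r → ℤ, ∑ i, a i • cs' i = 0 → ∀ i, a i • cs' i = 0 := by
    intro a ha i
    have hsum : ι (∑ j, a j • cs j) = 0 := by
      rw [map_sum]
      simpa only [map_zsmul] using ha
    have h := hind a (hιinj (by rw [hsum, map_zero])) i
    change a i • ι (cs i) = 0
    rw [← map_zsmul, h, map_zero]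
  -- ### the bound: above `b` and above the rational primes under the bad places of `E/K`
  have hbad : ((W.baseChange K).badPlaces (𝓞 K)).Finite := (W.baseChange K).finite_badPlaces_holds (𝓞 K)
  set B : ℕ := hbad.toFinset.sup fun w ↦ (Rat.HeightOneSpectrum.primesEquiv (w.under (𝓞 ℚ)) : ℕ)
    with hB
  have hM' : 1 ≤ M + k := le_trans hM (Nat.le_add_right M k)
  obtain ⟨ℓ, hbℓ, hKol, hfrob, hloc⟩ :=
    ShimuraKolyvaginCebotarevOfImage.McCallum1991_cor_3_2_pow_of_image (N := N) hC hK hp hp2 hIz hIs hIc hW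
      hM' hc cs' h0' Nv hN' hτ' hind' (max b B)
  have hb : b < ℓ := lt_of_le_of_lt (le_max_left b B) hbℓ
  have hBℓ : B < ℓ := lt_of_le_of_lt (le_max_right b B) hbℓ
  -- ### good reduction at `λ`
  have hgood : hKol.place ∉ (W.baseChange K).badPlaces (𝓞 K) := by
    intro hmem
    have hle : (Rat.HeightOneSpectrum.primesEquiv (hKol.place.under (𝓞 ℚ)) : ℕ) ≤ B :=
      Finset.le_sup (f := fun w : HeightOneSpectrum (𝓞 K) ↦
        (Rat.HeightOneSpectrum.primesEquiv (w.under (𝓞 ℚ)) : ℕ)) (hbad.mem_toFinset.mpr hmem)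
    have hℓeq : (Rat.HeightOneSpectrum.primesEquiv (hKol.place.under (𝓞 ℚ)) : ℕ) = ℓ := by
      rw [(natCast_mem_asIdeal_iff_eq_primesEquiv_symm _ hKol.prime).mp hKol.natCast_mem_under,
        Equiv.apply_symm_apply]
    omega
  -- ### `Γ_{K_λ}` fixes `E[p^{M+k}]`
  haveI : NeZero (p ^ (M + k)) := ⟨pow_ne_zero _ hp.ne_zero⟩
  have hpv : ((p : ℕ) : 𝓞 K) ∉ hKol.place.asIdeal :=
    not_natCast_mem_of_prime_ne hKol.prime hp hKol.2.2.2.1 hKol.place hKol.mem_place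
  have hqv : ((((p ^ (M + k) : ℕ) : ℤ)) : 𝓞 K) ∉ hKol.place.asIdeal := by
    rw [Int.cast_natCast, Nat.cast_pow]
    exact fun h ↦ hpv (hKol.place.isPrime.mem_of_pow_mem (M + k) h)
  have htriv : ∀ (g : absoluteGaloisGroup (hKol.place.adicCompletion K))
      (Q : geomTorsion (W.baseChange K) ((p ^ (M + k) : ℕ) : ℤ)),
      resGal (K := K) (hKol.place.adicCompletion K) g • Q = Q := fun g Q ↦ by
    rw [resGal_eq_absGaloisRestrict]
    exact absGaloisRestrict_smul_geomTorsion_eq_of_kolyvaginPrime W hK hKol hfrob hgood hqv g Q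
  -- ### assemble
  refine ⟨ℓ, hb, hKol, hfrob, fun i v hv ↦ ?_⟩
  rw [hKol.mem_iff.mp hv]
  have key := hloc i hKol.place hKol.mem_place
  have hpd : p ^ M ∣ p ^ (M + k) := pow_dvd_pow p (Nat.le_add_right M k)
  have hpM : p ^ M ≠ 0 := pow_ne_zero M hp.ne_zero
  have hpMk : p ^ (M + k) ≠ 0 := pow_ne_zero _ hp.ne_zero
  have e1 := mem_torsionLocalKer_iff_torsionH1OfDvd_mem (W.baseChange K) (hKol.place.adicCompletion K)
    hpd hpM hpMk htriv (((p : ℤ) ^ Nv i) • cs i)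
  have e2 := mem_torsionLocalKer_iff_torsionH1OfDvd_mem (W.baseChange K) (hKol.place.adicCompletion K)
    hpd hpM hpMk htriv (((p : ℤ) ^ (Nv i - 1)) • cs i)
  rw [map_zsmul] at e1 e2
  exact ⟨e1.mpr key.1, fun hi h ↦ key.2 hi (e2.mp h)⟩


end Summit.BirchSwinnertonDyer.BirchSwinnertonDyer.Theorems.ShimuraKolyvaginOfImage

end
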